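import Literature.RingTheory.RegularLocalRing.SopRegular
import Literature.RingTheory.TightClosure.TightClosure
import Mathlib.RingTheory.Regular.RegularSequence
import Mathlib.RingTheory.Regular.IsSMulRegular
import Mathlib.RingTheory.RegularLocalRing.Defs
import Mathlib.Algebra.CharP.Lemmas
import HarnessLib

/-!
# Colon capturing upstairs (the engine of "F-rational ⇒ Cohen–Macaulay")

Hochster–Huneke, *Tight closure, invariant theory, and the Briançon–Skoda theorem* (1990), §7
(Thm. 7.15-type argument); Huneke, *Tight Closure and its Applications*, Thm. 3.1.

Let `S` be a regular local ring of prime characteristic `p` and dimension `h + d`, `Q` a prime of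
`S`, and `y₁, …, y_h, x₁, …, x_d` a system of parameters of `S` with every `y_j ∈ Q`. Let `c ∈ S`
and `N` be such that `c · Qᴺ ⊆ (y)`. If `u · x_i ∈ (x_j : j < i) + Q`, then for every `q = p^e`
with `e ≥ N` (so `q ≥ N`):

`c · u^q ∈ (x_j^q : j < i) + Q`.

Proof (`colonCapturing_quotient`). Write `u x_i = a + w` with `a ∈ (x_j : j < i)`, `w ∈ Q`.
Frobenius gives `u^q x_i^q = a^q + w^q` with `a^q ∈ (x_j^q : j < i)` and `w^q ∈ Q^q ⊆ Qᴺ`, so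
`c u^q · x_i^q ∈ K := (x_j^q : j < i) + (y)`. The list `y₁, …, y_h, x₁^q, …, x_d^q` is again a
system of parameters of the regular local ring `S`, hence an `S`-regular sequence in this order
(`Literature.RingTheory.RegularLocalRing.isRegular_of_maximalIdeal_pow_le_ofList`, Matsumura
Thm. 17.4 (iii)); in particular `x_i^q` is a non-zero-divisor modulo `K`
(`colonCapturing_quotient_mem_of_mul_mem`), whence `c u^q ∈ K ⊆ (x_j^q : j < i) + Q`.
-/

-- single-problem summit: the doubled namespace component is forced
set_option linter.dupNamespace false

noncomputable section

open IsLocalRing RingTheory.Sequence Literature.RingTheory.TightClosure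
  Literature.RingTheory.RegularLocalRing

namespace Summit.ResolutionOfSingularities.ResolutionOfSingularities.Theorems.FRationalResolution

/-- Membership in an initial segment of `List.ofFn g`: `r ∈ (g₀, …, g_{i-1})` iff `r = g j` for
some `j < i`. -/
theorem colonCapturing_quotient_mem_take_ofFn {α : Type*} {d : ℕ} (g : Fin d → α) (i : Fin d)
    (r : α) : r ∈ (List.ofFn g).take i ↔ ∃ j : Fin d, j < i ∧ g j = r := by
  rw [List.mem_take_iff_getElem]
  constructor
  · rintro ⟨n, hn, rfl⟩
    rw [List.length_ofFn] at hn
    refine ⟨⟨n, lt_of_lt_of_le hn (min_le_right _ _)⟩, ?_, ?_⟩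
    · exact Fin.lt_def.mpr (lt_of_lt_of_le hn (min_le_left _ _))
    · rw [List.getElem_ofFn]
  · rintro ⟨j, hj, rfl⟩
    refine ⟨j, ?_, ?_⟩
    · rw [List.length_ofFn]
      exact lt_min (Fin.lt_def.mp hj) j.is_lt
    · rw [List.getElem_ofFn]

/-- **Regularity upstairs.** In a regular local ring `S` of dimension `h + d`, if
`y₁, …, y_h, g₁, …, g_d ∈ 𝔪` generate an `𝔪`-primary ideal (a system of parameters), then `g i`
is a non-zero-divisor modulo `(g j : j < i) + (y)`: from `v · g i ∈ (g j : j < i) + (y)` follows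
`v ∈ (g j : j < i) + (y)`. (The list `y ++ g` is an `S`-regular sequence in this order,
`isRegular_of_maximalIdeal_pow_le_ofList`.) -/
theorem colonCapturing_quotient_mem_of_mul_mem (S : Type) [CommRing S] [IsRegularLocalRing S]
    {d h : ℕ} (hdim : ringKrullDim S = ↑(h + d)) (y : Fin h → S) (g : Fin d → S)
    (hym : ∀ j, y j ∈ maximalIdeal S) (hgm : ∀ j, g j ∈ maximalIdeal S)
    (hrad : maximalIdeal S ≤ (Ideal.span (Set.range y ∪ Set.range g)).radical) (i : Fin d)
    (v : S) (hv : v * g i ∈ Ideal.span (g '' Set.Iio i) ⊔ Ideal.span (Set.range y)) :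
    v ∈ Ideal.span (g '' Set.Iio i) ⊔ Ideal.span (Set.range y) := by
  classical
  -- the list `y ++ g` is a system of parameters, hence an `S`-regular sequence
  have hLm : ∀ r ∈ List.ofFn y ++ List.ofFn g, r ∈ maximalIdeal S := by
    intro r hr
    rw [List.mem_append, List.mem_ofFn, List.mem_ofFn] at hr
    rcases hr with ⟨j, rfl⟩ | ⟨j, rfl⟩
    exacts [hym j, hgm j]
  have hlen : ((List.ofFn y ++ List.ofFn g).length : WithBot ℕ∞) = ringKrullDim S := by
    rw [List.length_append, List.length_ofFn, List.length_ofFn, hdim]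
  have hLrad : maximalIdeal S ≤ (Ideal.ofList (List.ofFn y ++ List.ofFn g)).radical := by
    refine hrad.trans (Ideal.radical_mono ?_)
    rw [Ideal.span_le]
    rintro r hr
    refine Ideal.subset_span ?_
    rw [Set.mem_setOf_eq, List.mem_append, List.mem_ofFn, List.mem_ofFn]
    rcases hr with ⟨j, rfl⟩ | ⟨j, rfl⟩
    exacts [Or.inl ⟨j, rfl⟩, Or.inr ⟨j, rfl⟩]
  obtain ⟨M, hM⟩ := Ideal.exists_pow_le_of_le_radical_of_fg hLrad (IsNoetherian.noetherian _)
  have hreg : IsRegular S (List.ofFn y ++ List.ofFn g) :=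
    isRegular_of_maximalIdeal_pow_le_ofList hLm hlen hM
  -- `g i` is regular modulo the first `h + i` members of the list
  have hlt : h + (i : ℕ) < (List.ofFn y ++ List.ofFn g).length := by
    rw [List.length_append, List.length_ofFn, List.length_ofFn]
    exact Nat.add_lt_add_left i.is_lt h
  have hsm := hreg.toIsWeaklyRegular.regular_mod_prev (h + i) hlt
  have htake : (List.ofFn y ++ List.ofFn g).take (h + i) = List.ofFn y ++ (List.ofFn g).take i := by
    have := List.take_length_add_append (l₁ := List.ofFn y) (l₂ := List.ofFn g) (i : ℕ)
    rwa [List.length_ofFn] at this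
  have hget : (List.ofFn y ++ List.ofFn g)[h + (i : ℕ)] = g i := by
    rw [List.getElem_append_right (by rw [List.length_ofFn]; exact Nat.le_add_right _ _),
      List.getElem_ofFn]
    congr 1
    ext
    simp only [List.length_ofFn, Nat.add_sub_cancel_left]
  rw [htake, hget] at hsm
  -- the ideal of that initial segment is `K := (g j : j < i) + (y)`
  have hK : Ideal.ofList (List.ofFn y ++ (List.ofFn g).take i) =
      Ideal.span (g '' Set.Iio i) ⊔ Ideal.span (Set.range y) := by
    have h1 : {r | r ∈ (List.ofFn g).take i} = g '' Set.Iio i := by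
      ext r
      simp only [Set.mem_setOf_eq, colonCapturing_quotient_mem_take_ofFn, Set.mem_image,
        Set.mem_Iio]
    have h2 : {r | r ∈ List.ofFn y} = Set.range y := by
      ext r
      simp only [Set.mem_setOf_eq, List.mem_ofFn, Set.mem_range]
    rw [Ideal.ofList_append]
    change Ideal.span _ ⊔ Ideal.span _ = _
    rw [h1, h2, sup_comm]
  rw [hK] at hsm
  have h1 : g i • v ∈
      ((Ideal.span (g '' Set.Iio i) ⊔ Ideal.span (Set.range y)) • ⊤ : Submodule S S) := by
    rw [Ideal.smul_eq_mul, Ideal.mul_top, smul_eq_mul, mul_comm]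
    exact hv
  have h2 := mem_of_isSMulRegular_quotient_of_smul_mem hsm h1
  rwa [Ideal.smul_eq_mul, Ideal.mul_top] at h2

/-- **Colon capturing upstairs** (Hochster–Huneke 1990, §7, Thm. 7.15-type; Huneke, *Tight Closure
and its Applications*, Thm. 3.1): `S` regular local of characteristic `p` and dimension `h + d`,
`Q` prime, `(y, x)` a system of parameters of `S` with `y ⊆ Q`, `c · Qᴺ ⊆ (y)`. If
`u · x_i ∈ (x_j : j < i) + Q` then `c · u^q ∈ (x_j^q : j < i) + Q` for all `q = p^e`, `e ≥ N`.
Frobenius (`(a + w)^q = a^q + w^q`, `w^q ∈ Q^q ⊆ Qᴺ`) puts `c u^q x_i^q` in `(x_j^q : j < i) + (y)`,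
and `x_i^q` is a non-zero-divisor modulo that ideal because `y, x^q` is a system of parameters of
the regular local ring `S` (`colonCapturing_quotient_mem_of_mul_mem`). -/
theorem colonCapturing_quotient (p : ℕ) [Fact p.Prime] (S : Type) [CommRing S]
    [IsRegularLocalRing S] [CharP S p] (Q : Ideal S) [Q.IsPrime] {d h : ℕ}
    (hdim : ringKrullDim S = ↑(h + d)) (y : Fin h → S) (x : Fin d → S) (hy : ∀ j, y j ∈ Q)
    (hsop : (Ideal.span (Set.range y ∪ Set.range x)).radical.IsMaximal) (c : S) (N : ℕ)
    (hcN : ∀ z ∈ Q ^ N, c * z ∈ Ideal.span (Set.range y)) (i : Fin d) (u : S)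
    (hu : u * x i ∈ Ideal.span (x '' Set.Iio i) ⊔ Q) :
    ∃ e₀ : ℕ, ∀ e : ℕ, e₀ ≤ e →
      c * u ^ p ^ e ∈ Ideal.span ((fun j : Fin d => x j ^ p ^ e) '' Set.Iio i) ⊔ Q := by
  have hp : p.Prime := Fact.out
  refine ⟨N, fun e he => ?_⟩
  have hNq : N ≤ p ^ e := he.trans (Nat.lt_pow_self hp.one_lt).le
  have hrad : (Ideal.span (Set.range y ∪ Set.range x)).radical = maximalIdeal S :=
    IsLocalRing.eq_maximalIdeal hsop
  have hym : ∀ j, y j ∈ maximalIdeal S := fun j =>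
    IsLocalRing.le_maximalIdeal (Ideal.IsPrime.ne_top ‹_›) (hy j)
  have hxm : ∀ j, x j ∈ maximalIdeal S := fun j =>
    hrad ▸ Ideal.le_radical (Ideal.subset_span (Or.inr ⟨j, rfl⟩))
  -- Frobenius: `c u^q x_i^q = c a^q + c w^q ∈ (x_j^q : j < i) + (y)`
  obtain ⟨a, ha, w, hw, haw⟩ := Submodule.mem_sup.mp hu
  have haq : a ^ p ^ e ∈ Ideal.span ((fun j : Fin d => x j ^ p ^ e) '' Set.Iio i) := by
    have h1 := pow_mem_frobeniusPower (q := p ^ e) ha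
    rwa [frobeniusPower_span p e, Set.image_image] at h1
  have hwq : c * w ^ p ^ e ∈ Ideal.span (Set.range y) :=
    hcN _ (Ideal.pow_le_pow_right hNq (Ideal.pow_mem_pow hw _))
  have hkey : c * u ^ p ^ e * x i ^ p ^ e ∈
      Ideal.span ((fun j : Fin d => x j ^ p ^ e) '' Set.Iio i) ⊔ Ideal.span (Set.range y) := by
    rw [mul_assoc, ← mul_pow, ← haw, add_pow_char_pow, mul_add]
    exact Submodule.add_mem_sup (Ideal.mul_mem_left _ _ haq) hwq
  -- regularity upstairs: `x_i^q` is a non-zero-divisor modulo `(x_j^q : j < i) + (y)`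
  have hmem := colonCapturing_quotient_mem_of_mul_mem S hdim y (fun j : Fin d => x j ^ p ^ e) hym
    (fun j => Ideal.pow_mem_of_mem _ (hxm j) _ (pow_pos hp.pos e)) ?_ i (c * u ^ p ^ e) hkey
  · exact (sup_le le_sup_left ((Ideal.span_le.mpr (by rintro _ ⟨j, rfl⟩; exact hy j)).trans
      le_sup_right) : Ideal.span ((fun j : Fin d => x j ^ p ^ e) '' Set.Iio i) ⊔
        Ideal.span (Set.range y) ≤ _) hmem
  · -- `𝔪 = rad (y, x) ≤ rad (y, x^q)`
    rw [← hrad]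
    refine Ideal.radical_le_radical_iff.mpr (Ideal.span_le.mpr ?_)
    rintro r (⟨j, rfl⟩ | ⟨j, rfl⟩)
    · exact Ideal.le_radical (Ideal.subset_span (Or.inl ⟨j, rfl⟩))
    · exact ⟨p ^ e, Ideal.subset_span (Or.inr ⟨j, rfl⟩)⟩

end Summit.ResolutionOfSingularities.ResolutionOfSingularities.Theorems.FRationalResolution

end
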